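/-
Copyright: the b2b-balaban cell (near-miss cell 7), T⁴-continuum fan-out, NE7b ROUND-2 swarm `t4-ne7b-formalise-*`
(seat leaf-01), row S6 «H2d zones» part 3a «tolerance bridge» of lineage t4-ne7b-p1's claim table `LEAVES-NE7b.md`.
Released under the licence of the surrounding project.
-/
import Summits.QuantumFields.BalabanUV.T4Continuum.Support.HistoryShapeRegions

/-!
# History zones, tolerant form: collared zones (`thickT`), dynamics with a step constant, and the count

Summits-side support leaf of the T⁴-continuum cell (rung (B)+1 on a FINITE torus only; NOT infinite volume, NOT the
mass gap, NOT the Clay statement; NOT a proof of the spine estimate NE7b).  NE7b ROUND-2 swarm, row S6 part 3a.  WHY: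
the geometric layer of record (row S1b, `Support/HistoryRealise`, holder leaf-08; R-OWNER-22-5 (1)) is PRINT-FAITHFUL —
a component's domain at step `t` is the S-image orbit (`B16SProfile.Siter`: coarsen, then TEN LAYERS of cubes), and two
partners of a join TOUCH (`B16MergeGeometry.Touch` of the current S-images) — while the landed zone reading
(`ZoneReading`∕`ZoneReadingS`) asks `zone (t+1) ⊆ blocks L (zone t)` (no layers) and a SHARED cell at a merger (finding
F-leaf08-1, my `NEEDS-S6.md` R2).  The bridge (journal l.6758): take as the zone of a structure the `c`-THICKENING of the
blocked union of its birth regions; by `B16SProfile.Siter_subset_biUnion_box` (orbits stay within the 31-boxes of the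
coarsened birth cubes) the orbits lie in the 31-thickening, so a `Touch` of orbits is a SHARED cell of the
32-thickenings, and the thickened zones obey the reading with ONE change: the step law carries a collar,
`zone (t+1) ⊆ thickT c (blocks L (zone t))`.  This file types that TOLERANT calculus, generically in the shape map
`sh : ε → PEv`; the extent dynamics get a step constant `cS` in place of `1`, the affine law the constant
`cS∕(1−σ²)`, and the count goes through UNCHANGED (`HistoryShapeCrowd.card_admZSet_grestrict_leS` takes any affine
constants).  [folklore] finite geometry and bookkeeping over the lineage's OWN carriers; nothing is quoted from print,
nothing printed is asserted, no `[cite:]` tag, no `Prop` fact minted (`ZoneDynC`, `ZoneReadingC` are HYPOTHESIS SHAPES).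

WHAT.
* §1 **`thickT m c S`** — the cells of `(ℤ∕m)^d` within cyclic sup-distance `c` of `S`: in range, monotone, contains
  `S`, distributes over unions, and **`diam_thickT_le`**: `diam (thickT m c S) ≤ diam S + 2c`.
* §2 **`ZoneDynC st wt σ Cb cS ext`** (= `ZoneExtentLaw.ZoneDyn` with step law `ext (t+1) ≤ σ²·ext t + cS`) and
  **`ext_le_affineC`**: `ext t X ≤ C₀·qZ wt σ st X t + cS∕(1−σ²)` for well-formed chronological `X` from its formation
  time on (`Cb ≤ C₀`, `cS∕(1−σ²) + 1 ≤ C₀`, `0 ≤ cS`); `guardExt_le_affineC`.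
* §3 **`ZoneReadingC sh n L K Cb c G zone`** — the six reading facts with the TOLERANT step
  `zone (t+1) X ⊆ thickT (n·L^{K−(t+1)}) c (blocks L (zone t X))`; **`zoneDynC_of_readingC`** (`cS = 2c + 1`),
  **`admZ_of_readingC`** ((p1)(p2) ⇒ the realized placement is zone-admissible; extents `HistoryShapeZones.extRS`).
* §4 **`card_admZSet_le_of_readingC`**: the (GM) multiplicity of a tagged genealogy read tolerantly —
  `Kz^{#merges G}·∏_{e ∈ merges G} Q(wcntS sh G,σ,(sh e).step)^d·(L^d)^{partnerAges (step∘sh) G}` with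
  `Kz = 2^d(C₀ + 2c₀ + 1)^d`, `c₀ = (2c+1)∕(1−σ²)`, `C₀ = max Cb (c₀ + 1)` — constants SYMBOLIC (c2∕c6).
* §5 sanity, decided (`thickT` on `ℤ∕7`).

Part 3b (`HistoryZonesOrbit.lean`): the zone map `thickT 32 ∘ regZoneS` read off birth regions, its reading from the
three birth-region laws with TOUCH-contact, and the ℤ^d-orbit → torus transport; part 3c: the binding to S1b's
`Realises`.  DISPLAYED until row S6f: `NoDropInLife` (one blocking by `L` per step).  NE7b discharge: no date.

HONEST DEPENDENCY (cell): continuum YM on T⁴ ⇐ BetaPertH ∧ nine spine estimates (0/9 proved); BetaPertH ⇐ (D1) ∧ (D4)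
∧ CAP+tail; G-an2-4 gates asym, D1 and NE2/3/4.  This file changes none of it.
-/

open Finset
open Literature.MathematicalPhysics.QuantumFieldTheory.Balaban1983to89
open T4PersistenceDictionary T4PartnerMultiplicity
open Summit.QuantumFields.BalabanUV.T4Continuum.PlacementSkeleton
open Summit.QuantumFields.BalabanUV.T4Continuum.Crowding
open Summit.QuantumFields.BalabanUV.T4Continuum.ZoneSkeleton
open Summit.QuantumFields.BalabanUV.T4Continuum.ZoneCrowd
open Summit.QuantumFields.BalabanUV.T4Continuum.ZoneTorus

namespace Summit.QuantumFields.BalabanUV.T4Continuum.HistoryZones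

noncomputable section

variable {d : ℕ}

/-! ## §1 Thickening on the torus -/

section Thick

open scoped Classical

/-- **THE `c`-THICKENING** of a zone on `(ℤ∕m)^d`: the cells in range `m` within cyclic sup-distance `c` of a cell of
`S`. [folklore] -/
def thickT (m c : ℕ) (S : Finset (Fin d → ℕ)) : Finset (Fin d → ℕ) :=
  (Fintype.piFinset fun _ : Fin d => range m).filter fun u => ∃ v ∈ S, cdist m u v ≤ c

/-- membership in the thickening [folklore] -/
theorem mem_thickT {m c : ℕ} {S : Finset (Fin d → ℕ)} {u : Fin d → ℕ} :
    u ∈ thickT m c S ↔ (∀ i, u i < m) ∧ ∃ v ∈ S, cdist m u v ≤ c := by simp [thickT, Fintype.mem_piFinset]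

/-- the thickening is in range [folklore] -/
theorem inRange_thickT (m c : ℕ) (S : Finset (Fin d → ℕ)) : InRange m (thickT m c S) :=
  fun _ hu => (mem_thickT.1 hu).1

/-- a zone in range lies in its thickening [folklore] -/
theorem subset_thickT {m : ℕ} (c : ℕ) {S : Finset (Fin d → ℕ)} (hS : InRange m S) : S ⊆ thickT m c S :=
  fun u hu => mem_thickT.2 ⟨hS u hu, u, hu, by simp [cdist]⟩

/-- the thickening is monotone [folklore] -/
theorem thickT_mono (m c : ℕ) {S T : Finset (Fin d → ℕ)} (h : S ⊆ T) : thickT m c S ⊆ thickT m c T := by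
  intro u hu
  obtain ⟨hr, v, hv, hd⟩ := mem_thickT.1 hu
  exact mem_thickT.2 ⟨hr, v, h hv, hd⟩

/-- the thickening distributes over unions [folklore] -/
theorem thickT_union (m c : ℕ) (S T : Finset (Fin d → ℕ)) : thickT m c (S ∪ T) = thickT m c S ∪ thickT m c T := by
  ext u
  simp only [mem_thickT, mem_union]
  constructor
  · rintro ⟨hr, v, hv | hv, hd⟩
    · exact Or.inl ⟨hr, v, hv, hd⟩
    · exact Or.inr ⟨hr, v, hv, hd⟩
  · rintro (⟨hr, v, hv, hd⟩ | ⟨hr, v, hv, hd⟩)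
    · exact ⟨hr, v, Or.inl hv, hd⟩
    · exact ⟨hr, v, Or.inr hv, hd⟩

/-- **THICKENING ENLARGES THE DIAMETER BY AT MOST `2c`.** [folklore] -/
theorem diam_thickT_le {m : ℕ} (c : ℕ) {S : Finset (Fin d → ℕ)} (hS : InRange m S) :
    diam m (thickT m c S) ≤ diam m S + 2 * c := by
  rw [diam_le_iff]
  intro u hu u' hu'
  obtain ⟨hur, v, hv, hd⟩ := mem_thickT.1 hu
  obtain ⟨hur', v', hv', hd'⟩ := mem_thickT.1 hu'
  calc cdist m u u' ≤ cdist m u v + cdist m v u' := cdist_triangle hur (hS v hv) hur'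
    _ ≤ cdist m u v + (cdist m v v' + cdist m v' u') :=
        Nat.add_le_add_left (cdist_triangle (hS v hv) (hS v' hv') hur') _
    _ ≤ c + (diam m S + c) := by
        rw [cdist_comm m v' u']; exact Nat.add_le_add hd (Nat.add_le_add (cdist_le_diam hv hv') hd')
    _ = diam m S + 2 * c := by ring

end Thick

/-! ## §2 Zone dynamics with a step constant, and the affine law -/

section Dyn

variable {ε : Type*}

/-- **ZONE DYNAMICS WITH A STEP CONSTANT** (`ZoneExtentLaw.ZoneDyn` with `1 ↦ cS` in the step law: one blocking step
contracts the extent by `σ²` up to the collar constant `cS`). [folklore] -/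
structure ZoneDynC (st : ε → ℕ) (wt : ε → ℝ) (σ Cb cS : ℝ) (ext : ℕ → Gen ε → ℝ) : Prop where
  /-- a new structure spans at most `Cb·wt b` at its formation step -/
  birth : ∀ (b : ε) (j : ℕ), ext (st b) (Gen.born b j) ≤ Cb * wt b
  /-- touching zones: the merged extent is at most the sum plus one -/
  merge : ∀ (X Y : Gen ε) (e : ε), ext (st e) (Gen.merge X Y e) ≤ ext (st e) X + ext (st e) Y + 1
  /-- one step contracts a formed structure's extent by `σ²` up to the collar constant -/
  step : ∀ (X : Gen ε) (t : ℕ), ftime st X ≤ t → ext (t + 1) X ≤ σ ^ 2 * ext t X + cS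
  /-- a renewal does not enlarge the zone -/
  renew : ∀ (G : Gen ε) (e : ε) (h t : ℕ), ext t (Gen.renew G e h) ≤ ext t G

variable [DecidableEq ε]

/-- **THE AFFINE CONTRACTION LAW FROM THE DYNAMICS WITH A STEP CONSTANT**: under `ZoneDynC st wt σ Cb cS ext`,
`0 ≤ σ < 1`, `0 ≤ cS`, weights `≥ 1`, `Cb ≤ C₀` and `cS∕(1−σ²) + 1 ≤ C₀`, every well-formed chronological structure
satisfies, from its formation time on, `ext t X ≤ C₀·qZ wt σ st X t + cS∕(1−σ²)`. [folklore] -/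
theorem ext_le_affineC (W : ε → ℕ) {st : ε → ℕ} {wt : ε → ℝ} (hwt : ∀ w, 1 ≤ wt w) {σ Cb cS C₀ : ℝ} (h0 : 0 ≤ σ)
    (h1 : σ < 1) (hcS : 0 ≤ cS) {ext : ℕ → Gen ε → ℝ} (dyn : ZoneDynC st wt σ Cb cS ext) (hCb : Cb ≤ C₀)
    (hC : cS / (1 - σ ^ 2) + 1 ≤ C₀) :
    ∀ {X : Gen ε}, X.WF W → Chrono st X → ∀ t, ftime st X ≤ t →
      ext t X ≤ C₀ * qZ wt σ st X t + cS / (1 - σ ^ 2) := by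
  have hwt0 : ∀ w, 0 ≤ wt w := fun w => zero_le_one.trans (hwt w)
  have hs1 : σ ^ 2 < 1 := by nlinarith
  have hs0 : 0 ≤ σ ^ 2 := sq_nonneg σ
  have hc0 : 0 ≤ cS / (1 - σ ^ 2) := div_nonneg hcS (sub_pos.2 hs1).le
  have hC0 : 0 ≤ C₀ := by linarith
  set c₀ := cS / (1 - σ ^ 2) with hc₀
  have hne : 1 - σ ^ 2 ≠ 0 := by linarith
  have hstep : σ ^ 2 * c₀ + cS = c₀ := by
    rw [hc₀]; field_simp; ring
  have prop : ∀ (X : Gen ε) (t₀ : ℕ), ftime st X ≤ t₀ → ext t₀ X ≤ C₀ * qZ wt σ st X t₀ + c₀ →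
      ∀ t, t₀ ≤ t → ext t X ≤ C₀ * qZ wt σ st X t + c₀ := by
    intro X t₀ hft h0' t ht
    induction t, ht using Nat.le_induction with
    | base => exact h0'
    | succ t ht ih =>
        have hq := sq_mul_qZ_le_succ wt hwt0 h0 h1.le st X t
        calc ext (t + 1) X ≤ σ ^ 2 * ext t X + cS := dyn.step X t (hft.trans ht)
          _ ≤ σ ^ 2 * (C₀ * qZ wt σ st X t + c₀) + cS := by nlinarith
          _ = C₀ * (σ ^ 2 * qZ wt σ st X t) + (σ ^ 2 * c₀ + cS) := by ring
          _ ≤ C₀ * qZ wt σ st X (t + 1) + c₀ := by rw [hstep]; nlinarith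
  intro X hW hchr
  induction X with
  | born b j =>
      refine prop _ _ le_rfl ?_
      rw [ftime, qZ_born, Nat.sub_self, mul_zero, pow_zero, mul_one]
      calc ext (st b) (Gen.born b j) ≤ Cb * wt b := dyn.birth b j
        _ ≤ C₀ * wt b + c₀ := by nlinarith [hwt0 b]
  | renew G e h ih =>
      intro t ht
      have := ih hW.1 hchr t ht
      rw [qZ_renew]
      exact (dyn.renew G e h t).trans this
  | merge X Y e ihX ihY =>
      obtain ⟨hfX, hfY⟩ := ftime_le_of_chrono st hchr
      have hX := ihX hW.1 hchr.1 (st e) hfX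
      have hY := ihY hW.2.1 hchr.2.1 (st e) hfY
      refine prop _ _ le_rfl ?_
      rw [show ftime st (Gen.merge X Y e) = st e from rfl, qZ_merge_eq W wt σ st hW, Nat.sub_self, mul_zero,
        pow_zero, mul_one]
      calc ext (st e) (Gen.merge X Y e) ≤ ext (st e) X + ext (st e) Y + 1 := dyn.merge X Y e
        _ ≤ C₀ * qZ wt σ st X (st e) + c₀ + (C₀ * qZ wt σ st Y (st e) + c₀) + 1 := by linarith
        _ ≤ C₀ * (qZ wt σ st X (st e) + qZ wt σ st Y (st e) + wt e) + c₀ := by nlinarith [hwt e]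

open scoped Classical in
/-- the affine law for ALL `t, X`, for the guarded extent `ZoneExtentLaw.guardExt` [folklore] -/
theorem guardExt_le_affineC (W : ε → ℕ) {st : ε → ℕ} {wt : ε → ℝ} (hwt : ∀ w, 1 ≤ wt w) {σ Cb cS C₀ : ℝ}
    (h0 : 0 ≤ σ) (h1 : σ < 1) (hcS : 0 ≤ cS) {ext : ℕ → Gen ε → ℝ} (dyn : ZoneDynC st wt σ Cb cS ext)
    (hCb : Cb ≤ C₀) (hC : cS / (1 - σ ^ 2) + 1 ≤ C₀) (t : ℕ) (X : Gen ε) :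
    guardExt W st ext t X ≤ C₀ * qZ wt σ st X t + cS / (1 - σ ^ 2) := by
  unfold guardExt
  split_ifs with h
  · exact ext_le_affineC W hwt h0 h1 hcS dyn hCb hC h.1 h.2.1 t h.2.2
  · have hs1 : σ ^ 2 < 1 := by nlinarith
    have hq : 0 ≤ qZ wt σ st X t := sum_nonneg fun w _ => mul_nonneg (zero_le_one.trans (hwt w)) (pow_nonneg h0 _)
    have hc0 : 0 ≤ cS / (1 - σ ^ 2) := div_nonneg hcS (sub_pos.2 hs1).le
    have hC0 : 0 ≤ C₀ := by linarith
    positivity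

end Dyn

/-! ## §3 The tolerant zone reading along a shape map -/

variable {ε : Type*} [DecidableEq ε] (sh : ε → PEv)

/-- **THE TOLERANT ZONE READING ALONG A SHAPE MAP**: `HistoryShapeZones.ZoneReadingS` with the step law carrying a
collar — one step later the zone lies inside the `c`-thickening of the blocked zone (the S-operation's layers). [folklore] -/
structure ZoneReadingC (n L K : ℕ) (Cb : ℝ) (c : ℕ) (G : Gen ε) (zone : ℕ → Gen ε → Finset (Fin d → ℕ)) : Prop where
  /-- zones at step `t` live on `(ℤ∕nL^{K−t})^d` -/
  inRange : ∀ (t : ℕ) (X : Gen ε), Sub X G → InRange (n * L ^ (K - t)) (zone t X)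
  /-- a birth's zone at its shape-step spans at most `Cb·wtPEv (sh b)` -/
  birth : ∀ (b : ε) (j : ℕ), Sub (Gen.born b j) G →
    (diam (n * L ^ (K - (sh b).step)) (zone (sh b).step (Gen.born b j)) : ℝ) ≤ Cb * wtPEv (sh b)
  /-- at the merger's shape-step the merged zone lies inside the union of the partners' zones -/
  union : ∀ (X Y : Gen ε) (e : ε), Sub (Gen.merge X Y e) G →
    zone (sh e).step (Gen.merge X Y e) ⊆ zone (sh e).step X ∪ zone (sh e).step Y
  /-- … and the partners' zones share a cell there -/
  overlap : ∀ (X Y : Gen ε) (e : ε), Sub (Gen.merge X Y e) G → ∃ z, z ∈ zone (sh e).step X ∧ z ∈ zone (sh e).step Y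
  /-- TOLERANT STEP: one step later the zone lies inside the `c`-thickening of the blocked zone -/
  step : ∀ (X : Gen ε) (t : ℕ), Sub X G → ftime (PEv.step ∘ sh) X ≤ t → t + 1 ≤ K →
    zone (t + 1) X ⊆ thickT (n * L ^ (K - (t + 1))) c (blocks L (zone t X))
  /-- a renewal adds nothing to the zone -/
  renew : ∀ (X : Gen ε) (e : ε) (h t : ℕ), Sub (Gen.renew X e h) G → zone t (Gen.renew X e h) ⊆ zone t X

section Reading

open scoped Classical

/-- **THE TOLERANT READING GIVES THE DYNAMICS WITH STEP CONSTANT `2c + 1`.** [folklore] -/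
theorem zoneDynC_of_readingC {n L K : ℕ} (hL : 1 ≤ L) {Cb σ : ℝ} (hCb : 0 ≤ Cb) (hσL : 1 / (L : ℝ) ≤ σ ^ 2) {c : ℕ}
    {G : Gen ε} (hchr : Chrono (PEv.step ∘ sh) G) {zone : ℕ → Gen ε → Finset (Fin d → ℕ)}
    (hR : ZoneReadingC sh n L K Cb c G zone) :
    ZoneDynC (PEv.step ∘ sh) (wtPEv ∘ sh) σ Cb (2 * c + 1) (extRS sh n L K G zone) := by
  have h0 : ∀ t X, 0 ≤ extRS sh n L K G zone t X := extRS_nonneg sh n L K G zone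
  refine ⟨fun b j => ?_, fun X Y e => ?_, fun X t hft => ?_, fun X e h t => ?_⟩
  · show extRS sh n L K G zone (sh b).step (Gen.born b j) ≤ Cb * wtPEv (sh b)
    unfold extRS
    split_ifs with hg
    · exact hR.birth b j hg.1
    · exact mul_nonneg hCb (wtPEv_nonneg _)
  · show extRS sh n L K G zone (sh e).step (Gen.merge X Y e) ≤
      extRS sh n L K G zone (sh e).step X + extRS sh n L K G zone (sh e).step Y + 1
    by_cases hg : Sub (Gen.merge X Y e) G ∧ ftime (PEv.step ∘ sh) (Gen.merge X Y e) ≤ (sh e).step ∧ (sh e).step ≤ K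
    · obtain ⟨hsub, -, hK⟩ := hg
      have hsX : Sub X G := Sub.trans (Sub.left Y e (Sub.refl X)) hsub
      have hsY : Sub Y G := Sub.trans (Sub.right X e (Sub.refl Y)) hsub
      obtain ⟨hfX, hfY⟩ := ftime_le_of_chrono (PEv.step ∘ sh) (chrono_of_sub (PEv.step ∘ sh) hsub hchr)
      simp only [Function.comp_apply] at hfX hfY
      rw [extRS_of_guard sh (t := (sh e).step) hsub le_rfl hK, extRS_of_guard sh hsX hfX hK,
        extRS_of_guard sh hsY hfY hK]
      obtain ⟨z, hzX, hzY⟩ := hR.overlap X Y e hsub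
      have h1 := diam_mono (m := n * L ^ (K - (sh e).step)) (hR.union X Y e hsub)
      have h2 := diam_union_le_of_overlap (hR.inRange _ X hsX) (hR.inRange _ Y hsY) hzX hzY
      have h3 : (diam (n * L ^ (K - (sh e).step)) (zone (sh e).step (Gen.merge X Y e)) : ℝ) ≤
          diam (n * L ^ (K - (sh e).step)) (zone (sh e).step X) +
            diam (n * L ^ (K - (sh e).step)) (zone (sh e).step Y) := by
        exact_mod_cast h1.trans h2
      linarith
    · have : extRS sh n L K G zone (sh e).step (Gen.merge X Y e) = 0 := by rw [extRS, if_neg hg]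
      rw [this]; linarith [h0 (sh e).step X, h0 (sh e).step Y]
  · by_cases hg : Sub X G ∧ ftime (PEv.step ∘ sh) X ≤ t + 1 ∧ t + 1 ≤ K
    · obtain ⟨hsub, -, hK⟩ := hg
      have hK' : t ≤ K := Nat.le_of_succ_le hK
      rw [extRS_of_guard sh hsub (Nat.le_succ_of_le hft) hK, extRS_of_guard sh hsub hft hK']
      have hm : n * L ^ (K - t) = n * L ^ (K - (t + 1)) * L := by
        rw [mul_assoc, ← pow_succ]; congr 2; omega
      have hIR : InRange (n * L ^ (K - (t + 1))) (blocks L (zone t X)) :=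
        inRange_blocks hL (by rw [← hm]; exact hR.inRange t X hsub)
      have h1 := diam_mono (m := n * L ^ (K - (t + 1))) (hR.step X t hsub hft hK)
      have h2 := diam_thickT_le c hIR
      have h3 := diam_blocks_le_real hL (n * L ^ (K - (t + 1))) (zone t X)
      rw [← hm] at h3
      have hD : (0 : ℝ) ≤ diam (n * L ^ (K - t)) (zone t X) := Nat.cast_nonneg _
      calc (diam (n * L ^ (K - (t + 1))) (zone (t + 1) X) : ℝ)
          ≤ diam (n * L ^ (K - (t + 1))) (thickT (n * L ^ (K - (t + 1))) c (blocks L (zone t X))) := by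
            exact_mod_cast h1
        _ ≤ diam (n * L ^ (K - (t + 1))) (blocks L (zone t X)) + 2 * c := by exact_mod_cast h2
        _ ≤ 1 / (L : ℝ) * diam (n * L ^ (K - t)) (zone t X) + 1 + 2 * c := by linarith
        _ ≤ σ ^ 2 * diam (n * L ^ (K - t)) (zone t X) + (2 * c + 1) := by nlinarith
    · have : extRS sh n L K G zone (t + 1) X = 0 := by rw [extRS, if_neg hg]
      rw [this]
      have : (0 : ℝ) ≤ 2 * c + 1 := by positivity
      nlinarith [h0 t X, sq_nonneg σ]
  · by_cases hg : Sub (Gen.renew X e h) G ∧ ftime (PEv.step ∘ sh) (Gen.renew X e h) ≤ t ∧ t ≤ K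
    · obtain ⟨hsub, hft, hK⟩ := hg
      have hsX : Sub X G := Sub.trans (Sub.renew e h (Sub.refl X)) hsub
      rw [extRS_of_guard sh hsub hft hK, extRS_of_guard sh hsX hft hK]
      exact_mod_cast diam_mono (hR.renew X e h t hsub)
    · have : extRS sh n L K G zone t (Gen.renew X e h) = 0 := by rw [extRS, if_neg hg]
      rw [this]; exact h0 t X

/-- **THE REALIZED PLACEMENT IS ZONE-ADMISSIBLE (tolerant reading).**  As `HistoryShapeZones.admZ_of_readingS`: only
`inRange` and `overlap` are used. [folklore] -/
theorem admZ_of_readingC {n L K : ℕ} {Cb : ℝ} {c : ℕ} {G : Gen ε} (hchr : Chrono (PEv.step ∘ sh) G)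
    (hK : ∀ e ∈ G.events, (sh e).step ≤ K) {zone : ℕ → Gen ε → Finset (Fin d → ℕ)}
    (hR : ZoneReadingC sh n L K Cb c G zone) {E : Finset ε} {G' : Gen ↥E} (hG : gmap Subtype.val G' = G)
    (P₀ : ↥E → TCell d (n * L ^ K)) (hscale : ∀ X' : Gen ↥E, Sub X' G' → IsScale L X'.rootStep (P₀ X'.root))
    (hroot : ∀ (X' Y' : Gen ↥E) (e' : ↥E), Sub (Gen.merge X' Y' e') G' →
      (fun i => (P₀ X'.root i).val / L ^ (sh e'.1).step) ∈ zone (sh e'.1).step (gmap Subtype.val X') ∧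
      (fun i => (P₀ Y'.root i).val / L ^ (sh e'.1).step) ∈ zone (sh e'.1).step (gmap Subtype.val Y')) :
    AdmZ (nearT n L K) (fun t Z => extRS sh n L K G zone t (gmap Subtype.val Z)) ((PEv.step ∘ sh) ∘ Subtype.val)
      G' P₀ := by
  suffices h : ∀ X' : Gen ↥E, Sub X' G' →
      AdmZ (nearT n L K) (fun t Z => extRS sh n L K G zone t (gmap Subtype.val Z)) ((PEv.step ∘ sh) ∘ Subtype.val)
        X' P₀ from h G' (Sub.refl _)
  intro X' hX'
  induction X' with
  | born b j => trivial
  | renew X e h ih => exact ih (Sub.trans (Sub.renew e h (Sub.refl X)) hX')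
  | merge A B e ihA ihB =>
      have hsA : Sub A G' := Sub.trans (Sub.left B e (Sub.refl A)) hX'
      have hsB : Sub B G' := Sub.trans (Sub.right A e (Sub.refl B)) hX'
      refine ⟨ihA hsA, ihB hsB, ?_⟩
      have hsub : Sub (gmap Subtype.val (Gen.merge A B e)) G := hG ▸ sub_gmap Subtype.val hX'
      have hsubA : Sub (gmap Subtype.val A) G := hG ▸ sub_gmap Subtype.val hsA
      have hsubB : Sub (gmap Subtype.val B) G := hG ▸ sub_gmap Subtype.val hsB
      have hchr' : Chrono (PEv.step ∘ sh) (Gen.merge (gmap Subtype.val A) (gmap Subtype.val B) e.1) :=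
        chrono_of_sub (PEv.step ∘ sh) hsub hchr
      obtain ⟨hfA, hfB⟩ := ftime_le_of_chrono (PEv.step ∘ sh) hchr'
      simp only [Function.comp_apply] at hfA hfB
      have heK : (sh e.1).step ≤ K := hK e.1 (events_subset_of_sub hsub (by simp [gmap]))
      show nearT n L K (P₀ A.root) A.rootStep (P₀ B.root) B.rootStep (sh e.1).step
        (extRS sh n L K G zone (sh e.1).step (gmap Subtype.val A) +
          extRS sh n L K G zone (sh e.1).step (gmap Subtype.val B))
      rw [extRS_of_guard sh hsubA hfA heK, extRS_of_guard sh hsubB hfB heK]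
      obtain ⟨z, hzA, hzB⟩ := hR.overlap _ _ e.1 hsub
      obtain ⟨hrA, hrB⟩ := hroot A B e hX'
      exact nearT_of_mem_overlap n L K heK (hscale A hsA) (hscale B hsB) (hR.inRange _ _ hsubA)
        (hR.inRange _ _ hsubB) hrA hrB hzA hzB

end Reading

/-! ## §4 The count under the tolerant reading -/

section Count

open scoped Classical

/-- **THE (GM) MULTIPLICITY OF A TAGGED GENEALOGY READ TOLERANTLY.**  For `G : Gen ε` well-formed, chronological for
`step ∘ sh`, with kind-`0` birth shapes and non-kind-`0` merger shapes, events in `E`, read by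
`ZoneReadingC sh n L K Cb c G zone` (`Cb ≥ 0`), and `0 ≤ σ < 1` with `1∕L ≤ σ²`: with `c₀ := (2c+1)∕(1−σ²)` and
`C₀ := max Cb (c₀ + 1)`, the zone-admissible torus placements of `grestrict E G hE` (extents `extRS`) with the root
piece at `z` number at most
`(2^d(C₀ + 2c₀ + 1)^d)^{#merges G}·(∏_{e ∈ merges G} Q(wcntS sh G,σ,(sh e).step)^(d:ℝ))·(L^d)^{partnerAges (step∘sh) G}`.
[folklore] -/
theorem card_admZSet_le_of_readingC (W : ε → ℕ) (n : ℕ) {L : ℕ} (hL : 1 ≤ L) (K : ℕ) {Cb σ : ℝ} (hCb : 0 ≤ Cb)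
    (h0 : 0 ≤ σ) (h1 : σ < 1) (hσL : 1 / (L : ℝ) ≤ σ ^ 2) {c : ℕ} {G : Gen ε} (hW : G.WF W)
    (hchr : Chrono (PEv.step ∘ sh) G) (hk0 : ∀ b ∈ births G, (sh b).kind = 0)
    (hk2 : ∀ m ∈ merges G, (sh m).kind ≠ 0) {zone : ℕ → Gen ε → Finset (Fin d → ℕ)}
    (hR : ZoneReadingC sh n L K Cb c G zone) (E : Finset ε) (hE : G.events ⊆ E) (z c₀' : TCell d (n * L ^ K)) :
    ((admZSet (nearT n L K) (fun t Z => extRS sh n L K G zone t (gmap Subtype.val Z))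
        ((PEv.step ∘ sh) ∘ Subtype.val) (grestrict E G hE) (grestrict E G hE).root z c₀').card : ℝ) ≤
      ((2 : ℝ) ^ d * (max Cb ((2 * c + 1) / (1 - σ ^ 2) + 1) + 2 * ((2 * c + 1) / (1 - σ ^ 2)) + 1) ^ d) ^
          (merges G).card *
        (∏ e ∈ merges G, Q (wcntS sh G) σ (sh e).step ^ (d : ℝ)) *
          ((L : ℝ) ^ d) ^ partnerAges (PEv.step ∘ sh) G := by
  have hs1 : σ ^ 2 < 1 := by nlinarith
  have hcS : (0 : ℝ) ≤ 2 * c + 1 := by positivity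
  have hc0 : 0 ≤ (2 * c + 1) / (1 - σ ^ 2) := div_nonneg hcS (sub_pos.2 hs1).le
  set C₀ := max Cb ((2 * c + 1) / (1 - σ ^ 2) + 1) with hC₀
  have hC : 0 ≤ C₀ := le_max_of_le_right (by linarith)
  have dyn := zoneDynC_of_readingC sh hL hCb hσL hchr hR
  have hlaw := guardExt_le_affineC W (fun w => one_le_wtPEv (sh w)) h0 h1 hcS dyn (le_max_left _ _)
    (le_max_right _ _)
  have hGG : gmap Subtype.val (grestrict E G hE) = G := gmap_grestrict E G hE
  have hset : admZSet (nearT n L K) (fun t Z => extRS sh n L K G zone t (gmap Subtype.val Z))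
        ((PEv.step ∘ sh) ∘ Subtype.val) (grestrict E G hE) (grestrict E G hE).root z c₀' =
      admZSet (nearT n L K) (fun t Z => guardExt W (PEv.step ∘ sh) (extRS sh n L K G zone) t (gmap Subtype.val Z))
        ((PEv.step ∘ sh) ∘ Subtype.val) (grestrict E G hE) (grestrict E G hE).root z c₀' := by
    unfold admZSet
    refine filter_congr fun P _ => ?_
    rw [admZ_guard_gmap_iff (nearT n L K) W (PEv.step ∘ sh) (extRS sh n L K G zone) Subtype.val
      (by rw [hGG]; exact hW) (by rw [hGG]; exact hchr) P]
  rw [hset]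
  exact card_admZSet_grestrict_leS sh W n hL K (guardExt W (PEv.step ∘ sh) (extRS sh n L K G zone))
    (guardExt_nonneg W (PEv.step ∘ sh) (extRS_nonneg sh n L K G zone)) hC hc0 h0 hlaw hW hchr hk0 hk2 E hE z c₀'

end Count

/-! ## §5 Sanity (decided) -/

namespace SanityC

/-- on `ℤ∕7` (one coordinate): the `1`-thickening of `{0}` is `{6, 0, 1}` (it wraps) -/
example : thickT 7 1 ({![0]} : Finset (Fin 1 → ℕ)) = {![0], ![1], ![6]} := by decide

end SanityC

end

end Summit.QuantumFields.BalabanUV.T4Continuum.HistoryZones
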